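import Summits.AtomisticToContinuum.Crystallization.Theses.ChessboardParticlePlanes

/-!
# Crux `ChessboardParticlePlanes.LjPlaneChessboard` (stmt-AtomisticToContinuum-6709), line `Sketch`,
# stub `stub_yukawaSlicing` — Lennard-Jones as a signed mixture of Yukawa potentials

The Lennard-Jones potential `V_LJ(r) = (1/12) r⁻¹² - (1/6) r⁻⁶` is not reflection positive
through planes, but it is a *signed* superposition of Yukawa potentials `e^{-mr}/r` (each of
which is):
`V_LJ(r) = ∫₀^∞ (m¹⁰/43545600 - m⁴/144) · e^{-mr}/r dm` for every `r > 0`.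
This is the elementary Laplace-transform ("Yukawa slicing") identity behind the chessboard
estimate: by Euler's integral `∫₀^∞ mⁿ e^{-mr} dm = n!/rⁿ⁺¹`, the two monomials
contribute `10!/43545600 · r⁻¹² = (1/12) r⁻¹²` and `4!/144 · r⁻⁶ = (1/6) r⁻⁶`.  [folklore]

We also record the sign of the slicing density `ρ(m) = m⁴/144 - m¹⁰/43545600` of `-V_LJ`:
it is positive exactly for `m⁶ < 302400` (`m < 302400^{1/6} ≈ 8.19`).

Main results:
* `integral_pow_mul_exp_neg_mul_Ioi` : `∫ m in Ioi 0, m ^ n * exp (-(m * r)) = n ! / r ^ (n + 1)`;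
* `stub_yukawaSlicing` : the slicing identity for `lennardJones`;
* `yukawaDensity_pos_iff` : the sign of the slicing density.
-/

noncomputable section

namespace Summit.AtomisticToContinuum.Crystallization.Theorems.ChessboardParticlePlanesLjPlaneChessboard

open Literature.MathematicalPhysics.StatisticalMechanics MeasureTheory

/-- Euler's integral for natural exponents: `∫₀^∞ mⁿ e^{-mr} dm = n!/rⁿ⁺¹` (`r > 0`),
from Mathlib's `Real.integral_rpow_mul_exp_neg_mul_Ioi` and `Γ(n+1) = n!`. [folklore] -/
theorem integral_pow_mul_exp_neg_mul_Ioi (n : ℕ) {r : ℝ} (hr : 0 < r) :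
    ∫ m in Set.Ioi (0 : ℝ), m ^ n * Real.exp (-(m * r)) =
      (n.factorial : ℝ) / r ^ (n + 1) := by
  have ha : (0 : ℝ) < (n : ℝ) + 1 := by positivity
  have h := Real.integral_rpow_mul_exp_neg_mul_Ioi ha hr
  have hcongr : ∫ m in Set.Ioi (0 : ℝ), m ^ n * Real.exp (-(m * r)) =
      ∫ t in Set.Ioi (0 : ℝ), t ^ ((n : ℝ) + 1 - 1) * Real.exp (-(r * t)) := by
    refine setIntegral_congr_fun measurableSet_Ioi (fun t _ => ?_)
    rw [add_sub_cancel_right, Real.rpow_natCast, mul_comm t r]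
  rw [hcongr, h, Real.Gamma_nat_eq_factorial,
    show (n : ℝ) + 1 = ((n + 1 : ℕ) : ℝ) by push_cast; ring, Real.rpow_natCast, one_div, inv_pow]
  ring

/-- The Euler integrand `mⁿ e^{-mr}` is integrable on `(0, ∞)` for `r > 0` (its integral
`n!/rⁿ⁺¹` is non-zero). [folklore] -/
theorem integrableOn_pow_mul_exp_neg_mul_Ioi (n : ℕ) {r : ℝ} (hr : 0 < r) :
    IntegrableOn (fun m : ℝ => m ^ n * Real.exp (-(m * r))) (Set.Ioi 0) := by
  refine Integrable.of_integral_ne_zero ?_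
  rw [integral_pow_mul_exp_neg_mul_Ioi n hr]
  positivity

/-- **Stub `stub_yukawaSlicing` — Lennard-Jones is a signed mixture of Yukawa potentials.**
For every `r > 0`,
`V_LJ(r) = (1/12) r⁻¹² - (1/6) r⁻⁶ = ∫₀^∞ (m¹⁰/43545600 - m⁴/144) · e^{-mr}/r dm`, by Euler's
integral `∫₀^∞ mⁿ e^{-mr} dm = n!/rⁿ⁺¹` (`integral_pow_mul_exp_neg_mul_Ioi`) with
`10!/43545600 = 3628800/43545600 = 1/12` and `4!/144 = 24/144 = 1/6`.  The slicing density
`m⁴/144 - m¹⁰/43545600` of `-V_LJ` is positive exactly for `m < 302400^{1/6} ≈ 8.19`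
(`yukawaDensity_pos_iff`); the signed mass beyond is the non-reflection-positive content of
the `(12,6)` potential. [folklore] -/
theorem stub_yukawaSlicing :
    ∀ r : ℝ, 0 < r →
      lennardJones r =
        ∫ m in Set.Ioi (0 : ℝ), (m ^ 10 / 43545600 - m ^ 4 / 144) * (Real.exp (-(m * r)) / r) := by
  intro r hr
  have i10 := (integrableOn_pow_mul_exp_neg_mul_Ioi 10 hr).const_mul (1 / (43545600 * r))
  have i4 := (integrableOn_pow_mul_exp_neg_mul_Ioi 4 hr).const_mul (1 / (144 * r))
  have hsplit : (fun m : ℝ => (m ^ 10 / 43545600 - m ^ 4 / 144) * (Real.exp (-(m * r)) / r)) =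
      fun m : ℝ => 1 / (43545600 * r) * (m ^ 10 * Real.exp (-(m * r))) -
        1 / (144 * r) * (m ^ 4 * Real.exp (-(m * r))) := by
    funext m
    field_simp
  rw [hsplit, integral_sub i10 i4, integral_const_mul, integral_const_mul,
    integral_pow_mul_exp_neg_mul_Ioi 10 hr, integral_pow_mul_exp_neg_mul_Ioi 4 hr]
  unfold lennardJones
  simp only [Nat.factorial, Nat.succ_eq_add_one]
  push_cast
  field_simp
  ring

/-- The sign of the Yukawa slicing density `ρ(m) = m⁴/144 - m¹⁰/43545600` of `-V_LJ`: for
`m > 0`, `ρ(m) > 0` iff `m⁶ < 302400 = 43545600/144` (i.e. `m < 302400^{1/6} ≈ 8.19`).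
[folklore] -/
theorem yukawaDensity_pos_iff {m : ℝ} (hm : 0 < m) :
    0 < m ^ 4 / 144 - m ^ 10 / 43545600 ↔ m ^ 6 < 302400 := by
  have h4 : 0 < m ^ 4 := by positivity
  have key : m ^ 4 / 144 - m ^ 10 / 43545600 = m ^ 4 / 43545600 * (302400 - m ^ 6) := by ring
  rw [key]
  constructor
  · intro h
    have := (mul_pos_iff_of_pos_left (by positivity : (0 : ℝ) < m ^ 4 / 43545600)).mp h
    linarith
  · intro h
    exact mul_pos (by positivity) (by linarith)

end Summit.AtomisticToContinuum.Crystallization.Theorems.ChessboardParticlePlanesLjPlaneChessboard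

end
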